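import Mathlib
import Literature.Probability.Percolation.ProdBernoulliRusso
import HarnessLib

/-!
# Russo's formula along a path of coin biases — signed form, within a set

Crux `stmt-CriticalPhenomena-10269`
(`Summit.CriticalPhenomena.CardyFormulaZ2.Theses.CardySelfRefinement.GradientComparability`),
line `Sketch`, stub `stub_russoWithin_signed`.

Maths. Let `A ⊆ Set ι` be an event determined by a finite set `K` of coordinates (no
monotonicity assumed), and let the coin biases `p b : ι → [0,1]` depend on a real parameter `b`
with `b ↦ p_e(b)` differentiable WITHIN a set `s ⊆ ℝ` at `β`, with derivative `p'_e`, for every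
`e ∈ K`. Then `b ↦ P_{p(b)}(A)` is differentiable within `s` at `β` with derivative
`Σ_{e ∈ K} p'_e · (P_{p(β)}{ω | ω ∪ {e} ∈ A} − P_{p(β)}{ω | ω ∖ {e} ∈ A})`.
This is Russo's formula in its multi-parameter, SIGNED form (Russo, Z. Wahrsch. 56 (1981), §4,
Lemma 3: `∂/∂x_i μ_x(A) = μ_x(A | i open) − μ_x(A | i closed)`, which for increasing `A` is
`μ_x(δ_i A)`; Grimmett, *Percolation* (1999), Thm. 2.25 and its proof), combined with the chain
rule along the path and stated with `HasDerivWithinAt`, so that clamped biases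
(`Set.projIcc 0 1`, differentiable only within `[0,1]` at the endpoints) are covered.

Proof: mirror of `Literature.Probability.Percolation.hasDerivAt_prodBernoulli_real`
(`ProdBernoulliRusso.lean`): the cylinder decomposition
`P_q(A) = Σ_{S ⊆ K, S ∈ A} ∏_{i ∈ K} w_i(S, q)` (`RussoPath.prodBernoulli_real_eq_sum_powerset`),
the product rule within `s`, the exchange of the two sums, and the pairing `S ↔ S ∪ {e}` over
`K.powerset = (K ∖ e).powerset ∪ insert e '' (K ∖ e).powerset`; the two conditional events
`{ω | ω ∪ {e} ∈ A}` and `{ω | ω ∖ {e} ∈ A}` are determined by `K ∖ {e}` and are expanded by the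
same cylinder decomposition over `K ∖ {e}`.
-/

noncomputable section

namespace Summit.CriticalPhenomena.CardyFormulaZ2.Theorems.CardySelfRefinement

open MeasureTheory Literature.Probability.LatticeModels Literature.Probability.Percolation

/-- If `A` is determined by `K`, then the event "`A` holds after opening `e`",
`{ω | insert e ω ∈ A}`, is determined by `K ∖ {e}` (Russo 1981, §4, proof of Lemma 3). -/
theorem determinedBy_setOf_insert_mem {ι : Type*} [DecidableEq ι] {A : Set (Set ι)}
    {K : Finset ι} (hA : DeterminedBy A (↑K : Set ι)) (e : ι) :
    DeterminedBy {ω | insert e ω ∈ A} (↑(K.erase e) : Set ι) := by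
  rw [determinedBy_iff] at hA ⊢
  intro ω ω' h
  simp only [Set.mem_setOf_eq]
  refine hA _ _ ?_
  ext i
  have hi := Set.ext_iff.1 h i
  simp only [Set.mem_inter_iff, Finset.coe_erase, Set.mem_sdiff, Finset.mem_coe,
    Set.mem_singleton_iff, Set.mem_insert_iff] at hi ⊢
  by_cases hie : i = e
  · subst hie
    simp only [true_or, true_and]
  · constructor
    · rintro ⟨h1, h2⟩
      rcases h1 with h1 | h1
      · exact absurd h1 hie
      · exact ⟨Or.inr (hi.1 ⟨h1, h2, hie⟩).1, h2⟩
    · rintro ⟨h1, h2⟩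
      rcases h1 with h1 | h1
      · exact absurd h1 hie
      · exact ⟨Or.inr (hi.2 ⟨h1, h2, hie⟩).1, h2⟩

/-- If `A` is determined by `K`, then the event "`A` holds after closing `e`",
`{ω | ω \ {e} ∈ A}`, is determined by `K ∖ {e}` (Russo 1981, §4, proof of Lemma 3). -/
theorem determinedBy_setOf_sdiff_mem {ι : Type*} [DecidableEq ι] {A : Set (Set ι)}
    {K : Finset ι} (hA : DeterminedBy A (↑K : Set ι)) (e : ι) :
    DeterminedBy {ω | ω \ {e} ∈ A} (↑(K.erase e) : Set ι) := by
  rw [determinedBy_iff] at hA ⊢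
  intro ω ω' h
  simp only [Set.mem_setOf_eq]
  refine hA _ _ ?_
  ext i
  have hi := Set.ext_iff.1 h i
  simp only [Set.mem_inter_iff, Finset.coe_erase, Set.mem_sdiff, Finset.mem_coe,
    Set.mem_singleton_iff] at hi ⊢
  by_cases hie : i = e
  · subst hie
    simp only [not_true_eq_false, and_false, false_and]
  · constructor
    · rintro ⟨⟨h1, -⟩, h2⟩
      exact ⟨⟨(hi.1 ⟨h1, h2, hie⟩).1, hie⟩, h2⟩
    · rintro ⟨⟨h1, -⟩, h2⟩
      exact ⟨⟨(hi.2 ⟨h1, h2, hie⟩).1, hie⟩, h2⟩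

/-- **Russo's formula along a path of coin biases, signed form, within a set** (Russo 1981, §4,
Lemma 3, multi-parameter form + chain rule; Grimmett 1999, Thm. 2.25). Let `A` be an event
determined by the finite set `K` (not necessarily monotone), and let the biases
`p b : ι → [0,1]` satisfy `HasDerivWithinAt (b ↦ p_e(b)) (p'_e) s β` for every `e ∈ K`. Then
`b ↦ P_{p(b)}(A)` has derivative
`Σ_{e ∈ K} p'_e · (P_{p(β)}{ω | insert e ω ∈ A} − P_{p(β)}{ω | ω \ {e} ∈ A})` within `s` at `β`. -/
theorem stub_russoWithin_signed {ι : Type*} [DecidableEq ι] (p : ℝ → ι → unitInterval)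
    (A : Set (Set ι)) {K : Finset ι} (hK : DeterminedBy A (↑K : Set ι)) (s : Set ℝ) (β : ℝ)
    (p' : ι → ℝ) (hp : ∀ e ∈ K, HasDerivWithinAt (fun b => (p b e : ℝ)) (p' e) s β) :
    HasDerivWithinAt (fun b => (prodBernoulli (p b)).real A)
      (∑ e ∈ K, p' e * ((prodBernoulli (p β)).real {ω | insert e ω ∈ A} -
        (prodBernoulli (p β)).real {ω | ω \ {e} ∈ A})) s β := by
  classical
  -- the weights and their derivatives
  set w : Finset ι → ι → ℝ → ℝ := fun S i b => if i ∈ S then (p b i : ℝ) else 1 - (p b i : ℝ)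
    with hw
  set dw : Finset ι → ι → ℝ := fun S i => if i ∈ S then p' i else -p' i with hdw
  have hwd : ∀ S, ∀ i ∈ K, HasDerivWithinAt (w S i) (dw S i) s β := by
    intro S i hi
    by_cases hiS : i ∈ S
    · have h1 : w S i = fun b => (p b i : ℝ) := by funext b; simp [hw, hiS]
      have h2 : dw S i = p' i := by simp [hdw, hiS]
      rw [h1, h2]; exact hp i hi
    · have h1 : w S i = fun b => 1 - (p b i : ℝ) := by funext b; simp [hw, hiS]
      have h2 : dw S i = -p' i := by simp [hdw, hiS]
      rw [h1, h2]; exact (hp i hi).const_sub 1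
  -- `P_{p(b)}(A)` is the cylinder polynomial
  have hrepr : (fun b => (prodBernoulli (p b)).real A) =
      fun b => ∑ S ∈ K.powerset, if (↑S : Set ι) ∈ A then ∏ i ∈ K, w S i b else 0 := by
    funext b
    rw [RussoPath.prodBernoulli_real_eq_sum_powerset hK (p b)]
  rw [hrepr]
  -- differentiate term by term, within `s`
  have hderiv : HasDerivWithinAt
      (fun b => ∑ S ∈ K.powerset, if (↑S : Set ι) ∈ A then ∏ i ∈ K, w S i b else 0)
      (∑ S ∈ K.powerset, if (↑S : Set ι) ∈ A then
        ∑ e ∈ K, (∏ j ∈ K.erase e, w S j β) * dw S e else 0) s β := by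
    refine HasDerivWithinAt.fun_sum fun S _ => ?_
    split_ifs with hSA
    · have := HasDerivWithinAt.fun_finsetProd (u := K) (x := β) (fun i hi => hwd S i hi)
      simpa [smul_eq_mul] using this
    · simpa using hasDerivWithinAt_const β s (0 : ℝ)
  -- exchange the sums and pair `S ↔ insert e S`
  convert hderiv using 1
  have hpush : (∑ S ∈ K.powerset, if (↑S : Set ι) ∈ A then
      ∑ e ∈ K, (∏ j ∈ K.erase e, w S j β) * dw S e else 0) =
      ∑ S ∈ K.powerset, ∑ e ∈ K, (if (↑S : Set ι) ∈ A then
        (∏ j ∈ K.erase e, w S j β) * dw S e else 0) := by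
    refine Finset.sum_congr rfl fun S _ => ?_
    split_ifs <;> simp
  rw [hpush, Finset.sum_comm]
  refine Finset.sum_congr rfl fun e he => ?_
  -- the `e`-th term: `p'_e · (P{insert e ω ∈ A} - P{ω \ {e} ∈ A})`, both events over `K.erase e`
  have hB1 : (prodBernoulli (p β)).real {ω | insert e ω ∈ A} =
      ∑ S ∈ (K.erase e).powerset, if (↑S : Set ι) ∈ {ω : Set ι | insert e ω ∈ A} then
        ∏ i ∈ K.erase e, w S i β else 0 :=
    RussoPath.prodBernoulli_real_eq_sum_powerset (determinedBy_setOf_insert_mem hK e) (p β)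
  have hB0 : (prodBernoulli (p β)).real {ω | ω \ {e} ∈ A} =
      ∑ S ∈ (K.erase e).powerset, if (↑S : Set ι) ∈ {ω : Set ι | ω \ {e} ∈ A} then
        ∏ i ∈ K.erase e, w S i β else 0 :=
    RussoPath.prodBernoulli_real_eq_sum_powerset (determinedBy_setOf_sdiff_mem hK e) (p β)
  rw [hB1, hB0, ← Finset.sum_sub_distrib, Finset.mul_sum]
  have hpow : K.powerset = (K.erase e).powerset ∪ (K.erase e).powerset.image (insert e) := by
    rw [← Finset.powerset_insert, Finset.insert_erase he]
  have hdisj : Disjoint (K.erase e).powerset ((K.erase e).powerset.image (insert e)) := by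
    rw [Finset.disjoint_left]
    intro S hS hS'
    obtain ⟨T, -, rfl⟩ := Finset.mem_image.1 hS'
    have := Finset.mem_powerset.1 hS (Finset.mem_insert_self e T)
    simp at this
  have hinj : Set.InjOn (insert e) (↑(K.erase e).powerset : Set (Finset ι)) := by
    intro S hS T hT hST
    have heS : e ∉ S := fun h => by simpa using Finset.mem_powerset.1 hS h
    have heT : e ∉ T := fun h => by simpa using Finset.mem_powerset.1 hT h
    rw [← Finset.erase_insert heS, ← Finset.erase_insert heT, hST]
  symm
  rw [hpow, Finset.sum_union hdisj, Finset.sum_image hinj, ← Finset.sum_add_distrib]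
  refine Finset.sum_congr rfl fun S hS => ?_
  have heS : e ∉ S := fun h => by simpa using Finset.mem_powerset.1 hS h
  have heS' : e ∉ (↑S : Set ι) := by simpa using heS
  have hdS : dw S e = -p' e := by simp [hdw, heS]
  have hdiS : dw (insert e S) e = p' e := by simp [hdw]
  -- off `e` the weights of `S` and `insert e S` agree
  have hwi : ∏ j ∈ K.erase e, w (insert e S) j β = ∏ j ∈ K.erase e, w S j β := by
    refine Finset.prod_congr rfl fun j hj => ?_
    have hje : j ≠ e := Finset.ne_of_mem_erase hj
    simp [hw, Finset.mem_insert, hje]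
  rw [hdS, hdiS, hwi, Finset.coe_insert]
  simp only [Set.mem_setOf_eq, Set.sdiff_singleton_eq_self heS']
  split_ifs <;> ring

end Summit.CriticalPhenomena.CardyFormulaZ2.Theorems.CardySelfRefinement

end
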